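import Literature.Geometry.Riemannian.ExpMapGaussLemma
import Literature.Geometry.Lorentzian.FutureNullCompleteness
import Literature.Geometry.Lorentzian.Causality
import HarnessLib

/-!
# Local Lorentz geometry in a normal exponential chart: timelike curves stay in the timecone
(O'Neill 1983, Ch. 5, Lemma 5.33 and Prop. 5.34)

Let `(M, g, τ)` be a time-oriented Lorentzian manifold (Hausdorff, without boundary, smooth
metric, `∞ ≤ n`) and `o ∈ M`. Write `exp_o : 𝓔_o → M` for the exponential map of the Levi-Civita
connection on its open domain `𝓔_o ⊆ T_oM = E` (`Literature.Geometry.Riemannian.expMap`), and for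
`v ∈ 𝓔_o` let `P_v = d(exp_o)_v(v)` be the **position (radial) vector** at `exp_o v` — the
velocity at `s = 1` of the radial geodesic `s ↦ exp_o(sv)` (`velocity_expMap_smul_eq_mfderiv`).
For a curve `β : [a, b] → 𝓔_o` (differentiable) put `α = exp_o ∘ β` and `q̃ ∘ β = g_o(β, β)`.
The computations of O'Neill's proof of Lemma 5.33 (p. 147) are, in this language:

* `d(q̃ ∘ β)/dt = 2 g_o(β', β)` (bilinearity, `hasDerivAt_val_self_comp`);
* **Gauss lemma** `g_o(β', β) = g(α', P_β)` (`val_deriv_self_eq_val_velocity_radial`, from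
  `Literature.Geometry.Riemannian.gaussLemma`, O'Neill Ch. 5, Lemma 5.1);
* on the timecone `P_v` is future timelike, on the causal cone future causal
  (`isTimelike_isFutureDirected_velocity_expMap_smul`, `isNull_…`: the causal character and the
  time orientation propagate along the radial geodesic).

From these: **O'Neill's Lemma 5.33 for differentiable curves**
(`radial_timecone_invariance`): if `α = exp_o ∘ β` is future causal (pointwise differentiable,
future-directed causal velocity) on `[a, b]` and `β(a)` lies in the future timecone of `T_oM`, then
`β(t)` stays in the future timecone for all `t ∈ [a, b]` and `q̃ ∘ β = g_o(β, β)` is strictly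
decreasing ("so long as `β` remains in `C`, … `d(q̃ ∘ β)/dt` remain[s] negative. But `β` can leave
`C` only by reaching either `0` or the nullcone, on both of which `q̃` is `0`"); and its causal-cone
companion `radial_causalcone_antitone` (`g_o(β, β)` is nonincreasing while `β` stays in the closed
future causal cone — O'Neill's remark after the proof, p. 147). Finally the easy half of
Prop. 5.34 / Lemma 14.2 (1): **a point `exp_o v` with `v` future timelike lies in `I⁺(o)`**, joined
by the radial geodesic (`expMap_mem_chronologicalFuture`), and with `v` future causal in `J⁺(o)`
(`expMap_mem_causalFuture`).

Deviation from the printed proof: O'Neill treats piecewise smooth curves and starts the curve AT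
`o` with timelike initial velocity ("initially `β` is in a single timecone"); here the curve is
merely differentiable (the tree's causal curves, `LorentzianMetric.IsFutureCausalCurveOn`) and
the hypothesis is that `β(a)` itself is in the open timecone, which is the form used downstream
(moving the base point slightly to the past, `TwoPointExpInverse.lean`) to reach null initial
velocities. The monotonicity arguments are the mean value theorem for everywhere-differentiable
real functions (`strictAntiOn_of_deriv_neg`, `antitoneOn_of_deriv_nonpos`) and a continuous
induction on `[a, b]`.

Everything is proved; no definitions and no named facts are introduced (D-0026). Written as
layer L0 (iv) of the programme for `ChruscielEtAl2001_areaTheorem` (causal curves between points of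
an achronal horizon are null generator segments).

## References

* B. O'Neill, *Semi-Riemannian geometry with applications to relativity*, Academic Press 1983,
  Ch. 5, Lemma 5.33 and Prop. 5.34 (pp. 146–147), Cor. 5.2 (position vector field, p. 128);
  Ch. 14, Lemma 14.2 (p. 402). [ONeillSemiRiemannian1983]
* J. M. Lee, *Introduction to Riemannian Manifolds*, 2nd ed. (2018), Thm. 6.9 (Gauss lemma).
  [LeeRiemannianManifolds2018]
-/

noncomputable section

open Bundle Set Filter Function
open scoped Manifold ContDiff Topology

namespace Literature.Geometry.Lorentzian

open Literature.Geometry.Riemannian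

variable {E : Type*} [NormedAddCommGroup E] [NormedSpace ℝ E] {H : Type*} [TopologicalSpace H]
  {I : ModelWithCorners ℝ E H} {M : Type*} [TopologicalSpace M] [ChartedSpace H M]
  [IsManifold I ∞ M] [FiniteDimensional ℝ E] [CompleteSpace E] [T2Space M]
  [BoundarylessManifold I M]

/-! ### Chain rules for the exponential map of a `C¹` connection -/

section Connection

variable {cov : CovariantDerivative I E (TangentSpace I : M → Type _)}
  [CovariantDerivative.ContMDiffCovariantDerivative cov 1]

/-- `exp_o` is differentiable at every point of its (open) domain `𝓔_o` (Lee 2018,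
Prop. 5.19 (a)); `T_oM` is read as the model space `E`. [cite: LeeRiemannianManifolds2018, Prop. 5.19 (a)] -/
theorem mdifferentiableAt_expMap_of_mem (o : M) {v : E}
    (hv : (v : TangentSpace I o) ∈ expDomain cov o) :
    MDifferentiableAt 𝓘(ℝ, E) I (fun u : E ↦ expMap cov o u) v := by
  have h1 : ContMDiffOn 𝓘(ℝ, E) I ((1 : ℕ∞) : ℕ∞ω) (fun u : E ↦ expMap cov o u)
      {u : E | (u : TangentSpace I o) ∈ expDomain cov o} :=
    contMDiffOn_expMap (cov := cov) (k := 1) le_rfl o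
  have h2 : IsOpen {u : E | (u : TangentSpace I o) ∈ expDomain cov o} :=
    isOpen_expDomain (cov := cov) (k := 1) le_rfl o
  exact (h1.contMDiffAt (h2.mem_nhds hv)).mdifferentiableAt (by simp)

/-- **Chain rule through `exp_o`**: the velocity of `t ↦ exp_o(β t)` at `t` is
`d(exp_o)_{β t}(β' t)`. [folklore] -/
theorem velocity_expMap_comp (o : M) {β : ℝ → E} {β' : E} {t : ℝ} (hβ : HasDerivAt β β' t)
    (hmem : (β t : TangentSpace I o) ∈ expDomain cov o) :
    velocity I (fun s ↦ expMap cov o (β s)) t =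
      mfderiv 𝓘(ℝ, E) I (fun u : E ↦ expMap cov o u) (β t) β' := by
  set ex : E → M := fun u ↦ expMap cov o u with hex
  have hexd : MDifferentiableAt 𝓘(ℝ, E) I ex (β t) := mdifferentiableAt_expMap_of_mem o hmem
  have hβm : HasMFDerivAt 𝓘(ℝ, ℝ) 𝓘(ℝ, E) β t
      (ContinuousLinearMap.smulRight (1 : ℝ →L[ℝ] ℝ) β') :=
    hasMFDerivAt_iff_hasFDerivAt.2 hβ.hasFDerivAt
  have hcomp := hexd.hasMFDerivAt.comp t hβm
  show mfderiv 𝓘(ℝ, ℝ) I (ex ∘ β) t 1 = _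
  rw [hcomp.mfderiv]
  show mfderiv 𝓘(ℝ, E) I ex (β t) (ContinuousLinearMap.smulRight (1 : ℝ →L[ℝ] ℝ) β' 1) = _
  simp

/-- **The position vector field along a radial geodesic**: the velocity of `r ↦ exp_o(r v)` at
`r = s` is `d(exp_o)_{sv}(v)` (O'Neill 1983, Ch. 5, p. 128: `P` is the velocity field of the
radial geodesics). [cite: ONeillSemiRiemannian1983, Ch. 5, Cor. 5.2 (p. 128)] -/
theorem velocity_expMap_smul_eq_mfderiv (o : M) (v : E) {s : ℝ}
    (hs : ((s • v : E) : TangentSpace I o) ∈ expDomain cov o) :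
    velocity I (fun r : ℝ ↦ expMap cov o ((r • v : E) : TangentSpace I o)) s =
      mfderiv 𝓘(ℝ, E) I (fun u : E ↦ expMap cov o u) (s • v) v := by
  have hline : HasDerivAt (fun r : ℝ ↦ r • v) v s := by
    simpa using (hasDerivAt_id' s).smul_const v
  exact velocity_expMap_comp (cov := cov) o hline hs

/-- At `s = 1`: `P_v = d(exp_o)_v(v)` is the velocity of the radial geodesic `r ↦ exp_o(rv)` at
`r = 1`. [cite: ONeillSemiRiemannian1983, Ch. 5, Cor. 5.2 (p. 128)] -/
theorem velocity_expMap_smul_one (o : M) {v : E} (hv : (v : TangentSpace I o) ∈ expDomain cov o) :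
    velocity I (fun r : ℝ ↦ expMap cov o ((r • v : E) : TangentSpace I o)) 1 =
      mfderiv 𝓘(ℝ, E) I (fun u : E ↦ expMap cov o u) v v := by
  have h := velocity_expMap_smul_eq_mfderiv (cov := cov) o v (s := 1) (by rwa [one_smul])
  rwa [one_smul] at h

/-- `d(exp_o)_0 = id` in use: for a curve `β` through `β t = 0`, the velocity of `exp_o ∘ β` at
`t` is `β' t` (Lee 2018, Prop. 5.19 (d)). [cite: LeeRiemannianManifolds2018, Prop. 5.19 (d)] -/
theorem velocity_expMap_comp_of_eq_zero (o : M) {β : ℝ → E} {β' : E} {t : ℝ}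
    (hβ : HasDerivAt β β' t) (h0 : β t = 0) :
    velocity I (fun s ↦ expMap cov o (β s)) t = β' := by
  have hmem : (β t : TangentSpace I o) ∈ expDomain cov o := by
    rw [h0]; exact zero_mem_expDomain (cov := cov) o
  have hid : mfderiv 𝓘(ℝ, E) I (fun u : E ↦ expMap cov o u) 0 β' = β' :=
    mfderiv_expMap_zero_apply (cov := cov) (k := 1) le_rfl o β'
  rw [velocity_expMap_comp (cov := cov) o hβ hmem, h0]
  exact hid

end Connection

/-! ### The radial vector field on the timecone and on the causal cone -/

section Lorentz

variable {n : ℕ∞ω} {g : LorentzianMetric I n M} [g.HasLeviCivita]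
  [CovariantDerivative.ContMDiffCovariantDerivative g.leviCivita 1] (τ : TimeOrientation g)

/-- **On the timecone the position vector field is future timelike**: if `v ∈ T_oM` is future
timelike then the radial geodesic `r ↦ exp_o(rv)` has future timelike velocity at every parameter
of its domain (constancy of `g(γ', γ')` and continuity of the time orientation along the geodesic;
O'Neill 1983, Ch. 5, proof of Lemma 5.33: "`P̃` is … timelike on `C`", and by the Gauss lemma so is
`P`). [cite: ONeillSemiRiemannian1983, Ch. 5, Lemma 5.33 (p. 147)] -/
theorem isTimelike_isFutureDirected_velocity_expMap_smul [Fact (1 ≤ n)] {o : M}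
    {v : TangentSpace I o} (hvt : g.IsTimelike v) (hvf : τ.IsFutureDirected v) {s : ℝ}
    (hs : s ∈ maximalGeodesicDomain g.leviCivita o v) :
    g.IsTimelike (velocity I (fun r : ℝ ↦ expMap g.leviCivita o (r • v)) s) ∧
      τ.IsFutureDirected (velocity I (fun r : ℝ ↦ expMap g.leviCivita o (r • v)) s) := by
  obtain ⟨hmax, h0, -, -⟩ := maximalGeodesic_spec' (cov := g.leviCivita) o v
  have hgeo := isGeodesicOn_expMap_smul (cov := g.leviCivita) o v
  have hv0 := velocity_expMap_smul_zero (cov := g.leviCivita) o v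
  have hb : expMap g.leviCivita o ((0 : ℝ) • v) = o := by
    rw [zero_smul]; exact expMap_zero (cov := g.leviCivita) o
  have h1 : g.IsTimelike (velocity I (fun r : ℝ ↦ expMap g.leviCivita o (r • v)) 0) := by
    rw [hv0, hb]; exact hvt
  have h2 : τ.IsFutureDirected (velocity I (fun r : ℝ ↦ expMap g.leviCivita o (r • v)) 0) := by
    rw [hv0, hb]; exact hvf
  exact hgeo.isTimelike_and_isFutureDirected_velocity τ hmax.isOpen hmax.2.1 h0 h1 h2 hs

/-- **On the causal cone the position vector field is future causal** (null twin of the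
previous lemma): for `v` future null the radial geodesic has future null velocity throughout.
[cite: ONeillSemiRiemannian1983, Ch. 5, Lemma 5.33 (p. 147)] -/
theorem isNull_isFutureDirected_velocity_expMap_smul [Fact (1 ≤ n)] {o : M}
    {v : TangentSpace I o} (hvn : g.IsNull v) (hvf : τ.IsFutureDirected v) {s : ℝ}
    (hs : s ∈ maximalGeodesicDomain g.leviCivita o v) :
    g.IsNull (velocity I (fun r : ℝ ↦ expMap g.leviCivita o (r • v)) s) ∧
      τ.IsFutureDirected (velocity I (fun r : ℝ ↦ expMap g.leviCivita o (r • v)) s) := by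
  obtain ⟨hmax, h0, -, -⟩ := maximalGeodesic_spec' (cov := g.leviCivita) o v
  have hgeo := isGeodesicOn_expMap_smul (cov := g.leviCivita) o v
  have hv0 := velocity_expMap_smul_zero (cov := g.leviCivita) o v
  have hb : expMap g.leviCivita o ((0 : ℝ) • v) = o := by
    rw [zero_smul]; exact expMap_zero (cov := g.leviCivita) o
  have h1 : g.IsNull (velocity I (fun r : ℝ ↦ expMap g.leviCivita o (r • v)) 0) := by
    rw [hv0, hb]; exact hvn
  have h2 : τ.IsFutureDirected (velocity I (fun r : ℝ ↦ expMap g.leviCivita o (r • v)) 0) := by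
    rw [hv0, hb]; exact hvf
  exact hgeo.isNull_and_isFutureDirected_velocity g τ hmax.isOpen hmax.2.1 h0 h1 h2 hs

/-- Future causal `v`: the radial geodesic has future causal velocity throughout its domain.
[cite: ONeillSemiRiemannian1983, Ch. 5, Lemma 5.33 (p. 147)] -/
theorem isFutureDirected_velocity_expMap_smul [Fact (1 ≤ n)] {o : M}
    {v : TangentSpace I o} (hvf : τ.IsFutureDirected v) {s : ℝ}
    (hs : s ∈ maximalGeodesicDomain g.leviCivita o v) :
    τ.IsFutureDirected (velocity I (fun r : ℝ ↦ expMap g.leviCivita o (r • v)) s) := by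
  rcases (g.isCausal_iff_isTimelike_or_isNull v).1 hvf.1 with hvt | hvn
  · exact (isTimelike_isFutureDirected_velocity_expMap_smul τ hvt hvf hs).2
  · exact (isNull_isFutureDirected_velocity_expMap_smul τ hvn hvf hs).2

/-- **`exp_o v ∈ I⁺(o)` for `v ∈ 𝓔_o` future timelike**: the radial geodesic
`r ↦ exp_o(rv)`, `r ∈ [0, 1]`, is a future timelike curve from `o` to `exp_o v` (O'Neill 1983,
Ch. 5, Prop. 5.34, "in particular `σ` is timelike"; Ch. 14, Lemma 14.2 (1)).
[cite: ONeillSemiRiemannian1983, Ch. 5, Prop. 5.34 (p. 147)] -/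
theorem expMap_mem_chronologicalFuture [Fact (1 ≤ n)] {o : M} {v : TangentSpace I o}
    (hv : v ∈ expDomain g.leviCivita o) (hvt : g.IsTimelike v) (hvf : τ.IsFutureDirected v) :
    expMap g.leviCivita o v ∈ g.chronologicalFuture τ {o} := by
  obtain ⟨hmax, h0, -, -⟩ := maximalGeodesic_spec' (cov := g.leviCivita) o v
  have h1 : (1 : ℝ) ∈ maximalGeodesicDomain g.leviCivita o v := hv.2
  have hgeo := isGeodesicOn_expMap_smul (cov := g.leviCivita) o v
  refine LorentzianMetric.mem_chronologicalFuture_iff.2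
    ⟨o, rfl, fun r : ℝ ↦ expMap g.leviCivita o (r • v), 0, 1, zero_lt_one, fun r hr ↦ ?_, ?_, ?_⟩
  · have hrD : r ∈ maximalGeodesicDomain g.leviCivita o v := hmax.2.1.out h0 h1 hr
    exact ⟨IsGeodesicOn.mdifferentiableAt_holds hgeo hrD,
      isTimelike_isFutureDirected_velocity_expMap_smul τ hvt hvf hrD⟩
  · show expMap g.leviCivita o ((0 : ℝ) • v) = o
    rw [zero_smul]
    exact expMap_zero (cov := g.leviCivita) o
  · show expMap g.leviCivita o ((1 : ℝ) • v) = _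
    rw [one_smul]

/-- **`exp_o v ∈ J⁺(o)` for `v ∈ 𝓔_o` future causal** (radial causal geodesic).
[cite: ONeillSemiRiemannian1983, Ch. 14, Lemma 14.2 (p. 402)] -/
theorem expMap_mem_causalFuture [Fact (1 ≤ n)] {o : M} {v : TangentSpace I o}
    (hv : v ∈ expDomain g.leviCivita o) (hvf : τ.IsFutureDirected v) :
    expMap g.leviCivita o v ∈ g.causalFuture τ {o} := by
  obtain ⟨hmax, h0, -, -⟩ := maximalGeodesic_spec' (cov := g.leviCivita) o v
  have h1 : (1 : ℝ) ∈ maximalGeodesicDomain g.leviCivita o v := hv.2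
  have hgeo := isGeodesicOn_expMap_smul (cov := g.leviCivita) o v
  refine LorentzianMetric.mem_causalFuture_iff.2 (Or.inr
    ⟨o, rfl, fun r : ℝ ↦ expMap g.leviCivita o (r • v), 0, 1, zero_lt_one, fun r hr ↦ ?_, ?_, ?_⟩)
  · have hrD : r ∈ maximalGeodesicDomain g.leviCivita o v := hmax.2.1.out h0 h1 hr
    exact ⟨IsGeodesicOn.mdifferentiableAt_holds hgeo hrD,
      isFutureDirected_velocity_expMap_smul τ hvf hrD⟩
  · show expMap g.leviCivita o ((0 : ℝ) • v) = o
    rw [zero_smul]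
    exact expMap_zero (cov := g.leviCivita) o
  · show expMap g.leviCivita o ((1 : ℝ) • v) = _
    rw [one_smul]

/-! ### The derivative of `q̃ ∘ β = g_o(β, β)` and the Gauss lemma along a curve -/

omit [FiniteDimensional ℝ E] [CompleteSpace E] [T2Space M] [BoundarylessManifold I M]
  [g.HasLeviCivita] [CovariantDerivative.ContMDiffCovariantDerivative g.leviCivita 1] in
/-- `d g_o(β, β)/dt = 2 g_o(β', β)` (O'Neill 1983, Ch. 5, proof of Lemma 5.33:
"`d(q̃ ∘ β)/dt = 2⟨β', P̃⟩`", with `grad q̃ = 2 P̃`). [cite: ONeillSemiRiemannian1983, Ch. 5, Lemma 5.33 (p. 147)] -/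
theorem hasDerivAt_val_self_comp (o : M) {β : ℝ → E} {β' : E} {t : ℝ} (hβ : HasDerivAt β β' t) :
    HasDerivAt (fun s ↦ g.val o (β s) (β s)) (2 * g.val o β' (β t)) t := by
  set B : E →L[ℝ] E →L[ℝ] ℝ := g.val o with hB
  have h := B.hasDerivAt_of_bilinear (fun _ ↦ hβ) (fun _ ↦ hβ)
  have h2 : B (β t) β' + B β' (β t) = 2 * B β' (β t) := by
    have hs : B (β t) β' = B β' (β t) := g.symm o (β t) β'
    rw [hs]
    ring
  rw [h2] at h
  exact h

omit [FiniteDimensional ℝ E] [CompleteSpace E] [T2Space M] [BoundarylessManifold I M]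
  [g.HasLeviCivita] [CovariantDerivative.ContMDiffCovariantDerivative g.leviCivita 1] in
/-- `d g_o(T, β)/dt = g_o(T, β')` for a fixed vector `T ∈ T_oM`. [folklore] -/
theorem hasDerivAt_val_const_comp (o : M) (T : TangentSpace I o) {β : ℝ → E} {β' : E} {t : ℝ}
    (hβ : HasDerivAt β β' t) :
    HasDerivAt (fun s ↦ g.val o T (β s)) (g.val o T β') t := by
  set L : E →L[ℝ] ℝ := g.val o T with hL
  exact L.hasFDerivAt.comp_hasDerivAt t hβ

/-- **The Gauss lemma along a curve**: for `β` differentiable at `t` with `β t ∈ 𝓔_o`,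
`g_o(β' t, β t) = g_{α t}(α' t, P_{β t})`, where `α = exp_o ∘ β` and `P_{β t}` is the velocity at
`r = 1` of the radial geodesic `r ↦ exp_o(r β t)` (O'Neill 1983, Ch. 5, proof of Lemma 5.33:
"by the Gauss lemma `⟨α', P⟩ = ⟨β', P̃⟩`"). [cite: ONeillSemiRiemannian1983, Ch. 5, Lemma 5.33 (p. 147)] -/
theorem val_deriv_self_eq_val_velocity_radial (hn : (∞ : ℕ∞ω) ≤ n) (o : M) {β : ℝ → E} {β' : E}
    {t : ℝ} (hβ : HasDerivAt β β' t)
    (hmem : (β t : TangentSpace I o) ∈ expDomain g.leviCivita o) :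
    g.val o β' (β t) = g.val (expMap g.leviCivita o (β t))
      (velocity I (fun s ↦ expMap g.leviCivita o (β s)) t)
      (velocity I (fun r : ℝ ↦ expMap g.leviCivita o ((r • β t : E) : TangentSpace I o)) 1) := by
  have hG : g.val (expMap g.leviCivita o (β t))
      (mfderiv 𝓘(ℝ, E) I (fun u : E ↦ expMap g.leviCivita o u) (β t) β')
      (mfderiv 𝓘(ℝ, E) I (fun u : E ↦ expMap g.leviCivita o u) (β t) (β t)) = g.val o β' (β t) :=
    gaussLemma g.toPseudoRiemannianMetric hn o hmem (β' : TangentSpace I o)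
  rw [← velocity_expMap_comp (cov := g.leviCivita) o hβ hmem,
    ← velocity_expMap_smul_one (cov := g.leviCivita) o hmem] at hG
  exact hG.symm

/-! ### O'Neill's Lemma 5.33: timelike curves stay in the timecone -/

/-- **O'Neill 1983, Ch. 5, Lemma 5.33 (for differentiable causal curves, started inside the
timecone).** Let `β : ℝ → T_oM = E` be differentiable at every `t ∈ [a, b]` with values in the
domain `𝓔_o` of `exp_o`, and suppose that `α = exp_o ∘ β` has future-directed causal velocity at
every `t ∈ [a, b]` and that `β a` is future timelike. Then `β t` is future timelike for every
`t ∈ [a, b]`, and `t ↦ g_o(β t, β t)` is strictly decreasing on `[a, b]`. Printed proof, p. 147: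
`d(q̃ ∘ β)/dt = 2⟨β', P̃⟩ = 2⟨α', P⟩ < 0` (Gauss lemma; `P` future timelike on the timecone, `α'`
future causal) "so long as `β` remains in `C` … But `β` can leave `C` only by reaching either `0`
or the nullcone, on both of which `q̃` is `0`" — here a continuous induction on `[a, b]`.
[cite: ONeillSemiRiemannian1983, Ch. 5, Lemma 5.33 (pp. 146–147)] -/
theorem radial_timecone_invariance (hn : (∞ : ℕ∞ω) ≤ n) {o : M} {β β' : ℝ → E} {a b : ℝ}
    (hβ : ∀ t ∈ Icc a b, HasDerivAt β (β' t) t)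
    (hdom : ∀ t ∈ Icc a b, (β t : TangentSpace I o) ∈ expDomain g.leviCivita o)
    (hfut : ∀ t ∈ Icc a b,
      τ.IsFutureDirected (velocity I (fun s ↦ expMap g.leviCivita o (β s)) t))
    (hat : g.IsTimelike (x := o) (β a)) (haf : τ.IsFutureDirected (x := o) (β a)) :
    (∀ t ∈ Icc a b, g.IsTimelike (x := o) (β t) ∧ τ.IsFutureDirected (x := o) (β t)) ∧
      StrictAntiOn (fun t ↦ g.val o (β t) (β t)) (Icc a b) := by
  haveI : Fact (1 ≤ n) := ⟨le_trans (by exact_mod_cast le_top) hn⟩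
  set f : ℝ → ℝ := fun t ↦ g.val o (β t) (β t) with hf
  -- the future timecone of `T_oM`, an open set
  set C : Set E := {v : E | g.IsTimelike (x := o) v ∧ τ.IsFutureDirected (x := o) v} with hC
  have hCo : IsOpen C := τ.isOpen_setOf_isTimelike_and_isFutureDirected o
  have hT : g.IsTimelike (τ.vectorField o) := τ.isTimelike o
  -- continuity of `β` and `f` on `[a, b]`
  have hβc : ∀ t ∈ Icc a b, ContinuousAt β t := fun t ht ↦ (hβ t ht).continuousAt
  have hf' : ∀ t ∈ Icc a b, HasDerivAt f (2 * g.val o (β' t) (β t)) t := fun t ht ↦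
    hasDerivAt_val_self_comp o (hβ t ht)
  have hfc : ContinuousOn f (Icc a b) := fun t ht ↦ (hf' t ht).continuousAt.continuousWithinAt
  -- KEY: where `β t ∈ C`, `f' t < 0`
  have hkey : ∀ t ∈ Icc a b, β t ∈ C → g.val o (β' t) (β t) < 0 := by
    intro t ht htC
    rw [val_deriv_self_eq_val_velocity_radial hn o (hβ t ht) (hdom t ht)]
    have hP := isTimelike_isFutureDirected_velocity_expMap_smul τ htC.1 htC.2
      (s := 1) (hdom t ht).2
    rw [one_smul] at hP
    have h := hP.2.val_lt_zero τ hP.1 (hfut t ht)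
    rwa [g.symm] at h
  -- (1) if `β ∈ C` on `[a, t)` and `a < t` then `f t < f a`
  have hflt : ∀ t ∈ Icc a b, a < t → (∀ s ∈ Ico a t, β s ∈ C) → f t < f a := by
    intro t ht hat' hgood
    have hsub : Icc a t ⊆ Icc a b := Icc_subset_Icc le_rfl ht.2
    have hanti : StrictAntiOn f (Icc a t) := by
      refine strictAntiOn_of_deriv_neg (convex_Icc a t) (hfc.mono hsub) fun s hs ↦ ?_
      rw [interior_Icc] at hs
      rw [(hf' s (hsub ⟨hs.1.le, hs.2.le⟩)).deriv]
      have := hkey s (hsub ⟨hs.1.le, hs.2.le⟩) (hgood s ⟨hs.1.le, hs.2⟩)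
      linarith
    exact hanti ⟨le_rfl, hat'.le⟩ ⟨hat'.le, le_rfl⟩ hat'
  have hfa : f a < 0 := hat
  -- (2) closure step: if `β ∈ C` on `[a, t)` then `β t ∈ C`
  have hclos : ∀ t ∈ Icc a b, (∀ s ∈ Ico a t, β s ∈ C) → β t ∈ C := by
    intro t ht hgood
    rcases eq_or_lt_of_le ht.1 with h | hat'
    · rw [← h]; exact ⟨hat, haf⟩
    -- `f t < 0`: `β t` is timelike
    have hft : f t < 0 := (hflt t ht hat' hgood).trans hfa
    have htl : g.IsTimelike (x := o) (β t) := hft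
    -- `g_o(T, β t) ≤ 0` by continuity from the left, and `≠ 0`
    have hle : g.val o (τ.vectorField o) (β t) ≤ 0 := by
      set L : E →L[ℝ] ℝ := g.val o (τ.vectorField o) with hL
      have hcont : ContinuousWithinAt (fun s ↦ L (β s)) (Ico a t) t :=
        (L.continuous.continuousAt.comp (hβc t ht)).continuousWithinAt
      have hmem : t ∈ closure (Ico a t) := by
        rw [closure_Ico hat'.ne]; exact ⟨hat'.le, le_rfl⟩
      exact ContinuousWithinAt.closure_le (f := fun s ↦ L (β s))
        (g := fun _ ↦ (0 : ℝ)) hmem hcont continuousWithinAt_const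
        fun s hs ↦ ((hgood s hs).2.2).le
    have hne : g.val o (τ.vectorField o) (β t) ≠ 0 :=
      g.val_ne_zero_of_isTimelike_of_isCausal hT htl.isCausal
    exact ⟨htl, htl.isCausal, lt_of_le_of_ne hle hne⟩
  -- (3) continuous induction: `β t ∈ C` for all `t ∈ [a, b]`
  have hall : ∀ t ∈ Icc a b, β t ∈ C := by
    -- the set of `t` such that `β ∈ C` on `[a, t] ∩ (-∞, b]`
    set S : Set ℝ := {t | ∀ s ∈ Icc a t, s ≤ b → β s ∈ C} with hS
    have hSa : a ∈ S := fun s hs _ ↦ by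
      rw [le_antisymm hs.2 hs.1]; exact ⟨hat, haf⟩
    suffices h : Icc a b ⊆ S from fun t ht ↦ h ht t ⟨ht.1, le_rfl⟩ ht.2
    refine IsClosed.Icc_subset_of_forall_exists_gt ?_ hSa ?_
    · -- closedness of `S ∩ [a, b]`
      rw [← closure_subset_iff_isClosed]
      intro t ht
      have htab : t ∈ Icc a b :=
        (closure_Icc a b).subset (closure_mono inter_subset_right ht)
      refine ⟨fun s hs hsb ↦ ?_, htab⟩
      rcases hs.2.lt_or_eq with hst | h
      · -- some point of `S ∩ [a,b]` lies beyond `s`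
        rw [Metric.mem_closure_iff] at ht
        obtain ⟨t', ht'S, hdist⟩ := ht (t - s) (by linarith)
        have hst' : s ≤ t' := by
          rw [Real.dist_eq] at hdist
          have := abs_lt.1 hdist
          linarith [this.1, this.2]
        exact ht'S.1 s ⟨hs.1, hst'⟩ hsb
      · -- the endpoint itself: closure step
        rw [h]
        refine hclos t htab fun s' hs' ↦ ?_
        rw [Metric.mem_closure_iff] at ht
        obtain ⟨t', ht'S, hdist⟩ := ht (t - s') (by linarith [hs'.2])
        have hst' : s' ≤ t' := by
          rw [Real.dist_eq] at hdist
          have := abs_lt.1 hdist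
          linarith [this.1, this.2]
        exact ht'S.1 s' ⟨hs'.1, hst'⟩ (by linarith [hs'.2, htab.2])
    · -- no maximal element below `b`: openness of `C`
      rintro t ⟨htS, hta, htb⟩ y hy
      have htC : β t ∈ C := htS t ⟨hta, le_rfl⟩ htb.le
      have hev : ∀ᶠ s in 𝓝 t, β s ∈ C :=
        (hβc t ⟨hta, htb.le⟩).preimage_mem_nhds (hCo.mem_nhds htC)
      obtain ⟨δ, hδ, hball⟩ := Metric.eventually_nhds_iff.1 hev
      set t' := min (min (t + δ / 2) b) y with ht'
      have htt' : t < t' := by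
        simp only [ht', lt_min_iff]; exact ⟨⟨by linarith, htb⟩, hy⟩
      refine ⟨t', ⟨fun s hs hsb ↦ ?_, htt', min_le_right _ _⟩⟩
      rcases le_or_gt s t with hst | hst
      · exact htS s ⟨hs.1, hst⟩ hsb
      · refine hball ?_
        rw [Real.dist_eq, abs_lt]
        have h1 : s ≤ t + δ / 2 := hs.2.trans ((min_le_left _ _).trans (min_le_left _ _))
        constructor <;> linarith
  refine ⟨fun t ht ↦ hall t ht, ?_⟩
  -- strict decrease of `f` on `[a, b]`
  refine strictAntiOn_of_deriv_neg (convex_Icc a b) hfc fun s hs ↦ ?_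
  rw [interior_Icc] at hs
  rw [(hf' s ⟨hs.1.le, hs.2.le⟩).deriv]
  have := hkey s ⟨hs.1.le, hs.2.le⟩ (hall s ⟨hs.1.le, hs.2.le⟩)
  linarith

/-! ### The causal-cone version: `g_o(β, β)` is nonincreasing -/

/-- **O'Neill 1983, Ch. 5, Lemma 5.33, causal form of the monotonicity** ("the lemma remains true
if the words timelike and timecone are replaced by causal and causal cone", p. 147): if
`α = exp_o ∘ β` has future-directed causal velocity on `[a, b]` and `β t` lies in the closed future
causal cone of `T_oM` (`g_o(β,β) ≤ 0`, `g_o(T_o, β) ≤ 0`) for every `t ∈ [a, b]`, then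
`g_o(β' t, β t) = g(α', P) ≤ 0` on `[a, b]` (`P` being future causal or zero) and
`t ↦ g_o(β t, β t)` is nonincreasing on `[a, b]`. [cite: ONeillSemiRiemannian1983, Ch. 5, Lemma 5.33 (p. 147)] -/
theorem radial_causalcone_antitone (hn : (∞ : ℕ∞ω) ≤ n) {o : M} {β β' : ℝ → E} {a b : ℝ}
    (hβ : ∀ t ∈ Icc a b, HasDerivAt β (β' t) t)
    (hdom : ∀ t ∈ Icc a b, (β t : TangentSpace I o) ∈ expDomain g.leviCivita o)
    (hfut : ∀ t ∈ Icc a b,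
      τ.IsFutureDirected (velocity I (fun s ↦ expMap g.leviCivita o (β s)) t))
    (hcone : ∀ t ∈ Icc a b, g.val o (β t) (β t) ≤ 0 ∧ g.val o (τ.vectorField o) (β t) ≤ 0) :
    (∀ t ∈ Icc a b, g.val o (β' t) (β t) ≤ 0) ∧
      AntitoneOn (fun t ↦ g.val o (β t) (β t)) (Icc a b) := by
  haveI : Fact (1 ≤ n) := ⟨le_trans (by exact_mod_cast le_top) hn⟩
  set f : ℝ → ℝ := fun t ↦ g.val o (β t) (β t) with hf
  have hT : g.IsTimelike (τ.vectorField o) := τ.isTimelike o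
  have hf' : ∀ t ∈ Icc a b, HasDerivAt f (2 * g.val o (β' t) (β t)) t := fun t ht ↦
    hasDerivAt_val_self_comp o (hβ t ht)
  have hfc : ContinuousOn f (Icc a b) := fun t ht ↦ (hf' t ht).continuousAt.continuousWithinAt
  -- KEY: `g_o(β', β) = g(α', P) ≤ 0`
  have hkey : ∀ t ∈ Icc a b, g.val o (β' t) (β t) ≤ 0 := by
    intro t ht
    rw [val_deriv_self_eq_val_velocity_radial hn o (hβ t ht) (hdom t ht)]
    by_cases h0 : β t = 0
    · -- the radial curve is constant: `P = 0`
      have hP : velocity I (fun r : ℝ ↦ expMap g.leviCivita o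
          ((r • β t : E) : TangentSpace I o)) 1 = 0 := by
        have hc : (fun r : ℝ ↦ expMap g.leviCivita o ((r • β t : E) : TangentSpace I o)) =
            fun _ ↦ o := by
          funext r
          rw [h0, smul_zero]
          exact expMap_zero (cov := g.leviCivita) o
        rw [hc]
        exact velocity_const (I := I) o 1
      rw [hP]
      exact le_of_eq (map_zero _)
    · -- `β t` is future causal, so `P` is future causal
      have hcausal : g.IsCausal (x := o) (β t) := ⟨(hcone t ht).1, h0⟩
      have hfd : τ.IsFutureDirected (x := o) (β t) :=
        ⟨hcausal, lt_of_le_of_ne (hcone t ht).2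
          (g.val_ne_zero_of_isTimelike_of_isCausal hT hcausal)⟩
      have hP := isFutureDirected_velocity_expMap_smul τ hfd (s := 1) (hdom t ht).2
      rw [one_smul] at hP
      exact (hfut t ht).val_nonpos τ hP
  refine ⟨hkey, antitoneOn_of_deriv_nonpos (convex_Icc a b) hfc (fun s hs ↦ ?_) fun s hs ↦ ?_⟩
  · rw [interior_Icc] at hs
    exact (hf' s ⟨hs.1.le, hs.2.le⟩).differentiableAt.differentiableWithinAt
  · rw [interior_Icc] at hs
    rw [(hf' s ⟨hs.1.le, hs.2.le⟩).deriv]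
    have := hkey s ⟨hs.1.le, hs.2.le⟩
    linarith

end Lorentz

end Literature.Geometry.Lorentzian
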